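/-
Copyright (c) 2026. All rights reserved.
Released under Apache 2.0 license as described in the file LICENSE.
Authors: abc-iut cell, seat abc-iut-L4-t14 (gen 3; proof-only capstone: the functor
`Loc(PSL₂(ℝ), Γ̄) ⥤ HolRS`, `Λ̄ ↦ ℍ/Λ̄`, is FULLY FAITHFUL — the group model IS the uniformised `EA`
over `X = ℍ/Γ̄` on objects of the form `ℍ/Λ̄`).
-/
import Literature.AnabelianGeometry.AbsoluteAnabelian.ArchimedeanHolFieldFunctorGeometricPSL
import Literature.AnabelianGeometry.AbsoluteAnabelian.ArchimedeanHolFieldFunctorGeometricCovers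
import Literature.Topology.CoveringSpaces.UniformizedConnectedCovers
import HarnessLib

/-!
# `Loc(PSL₂(ℝ), Γ̄) ⥤ HolRS` is fully faithful ([AbsTopIII] Prop 4.2 (i): «objects mapping to X ≅ Loc_R(X)»)

S. Mochizuki, *Topics in absolute anabelian geometry III*, proof of Prop 4.2 (i) p. 106 l. 14–19
(kurims manuscript `paper:url-5493eb38cbb7`; bib key `MochizukiAbsTopIII2015`): "the full subcategory of
`EA` consisting of objects that map to `X` may, by Corollary 2.3, (i) …, be identified with the category
of finite étale R-localizations `Loc_R(X)`".

PROOF-ONLY capstone (no new notion) of abc-iut-L4-t14's chain `LocCategoryGroupModel` (p432943: the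
group model `Loc(N, Γ)`) → `ArchimedeanHolFieldFunctorGeometricQuotient` (p438080: `Λ ↦ X̃/Λ` as a
functor to `HolRS`) → `…UpperHalfPlane` (p438658) → `…PSL` (`PSL₂(ℝ)` acting faithfully on `ℍ`,
`pslLocFunctor`, sign-free fullness `exists_psl_of_hom` over abc-iut-w5-d208's Möbius lifting
`UniformizedCoverLiftPSL2R`):

* `HolRS.pslLocFunctor_full` — **FULL**: every morphism `ℍ/Λ̄₁ ⟶ ℍ/Λ̄₂` of `HolRS` between objects of
  `Loc(PSL₂(ℝ), Γ̄)` is the image of a morphism `[q] : Λ̄₁ → Λ̄₂` (`exists_psl_of_hom`);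
* `HolRS.pslLocFunctor_faithful` — **FAITHFUL**: if `[τ] ↦ [q • τ]` and `[τ] ↦ [q' • τ]` agree as maps
  `ℍ/Λ̄₁ → ℍ/Λ̄₂` then `q' q⁻¹ ∈ Λ̄₂`, i.e. `[q] = [q']` in `Loc` (uniqueness of based lifts,
  `UniformizedLift.lift_unique`, and faithfulness of the `PSL₂(ℝ)`-action, `psl_eq_one_of_forall_smul_eq`);
* ★ `HolRS.isEquivalence_lift_pslLocFunctor` — the lift of `pslLocFunctor` to the full subcategory
  `{Y ∈ HolRS | Nonempty (Y ⟶ ℍ/Γ̄)}` IS AN EQUIVALENCE OF CATEGORIES (full + faithful + ess. surj.);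
* `HolRS.exists_iso_pslLocFunctor_obj` — **ESSENTIALLY SURJECTIVE onto «objects mapping to `ℍ/Γ̄`»**:
  every `Y : HolRS` with a morphism `Y ⟶ ℍ/Γ̄` is isomorphic to `ℍ/Λ̄` for an object `Λ̄` of
  `Loc(PSL₂(ℝ), Γ̄)` (abc-iut-w5-d208's `SimplyConnectedCover.exists_subgroup_homeomorph_orbitQuotient` /
  `finiteIndex_of_finite_fibre`, Hatcher Thm 1.38, and abc-iut-L4-t12's `HolRS.isoOfHomeomorphOver`).

Hence, for a torsion-free Fuchsian group `Γ̄ ≤ PSL₂(ℝ)` (acting freely and properly discontinuously on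
`ℍ`) and under the finite-fibre hypothesis `hfin`, the group model `Loc(PSL₂(ℝ), Γ̄)` is EQUIVALENT to the
full subcategory of the holomorphic geometric `EA` (`HolRS`) on the uniformised objects `ℍ/Λ̄`,
`[Γ̄ : Λ̄] < ∞` — the kernel form, at the model, of the printed identification «objects of `EA` that map to
`X`» ≅ `Loc_R(X)` modulo (i) essential surjectivity (every object mapping to `ℍ/Γ̄` is some `ℍ/Λ̄`:
uniformisation / topological Galois correspondence, abc-iut-w5-d208 / w5-d144 lineages) and (ii) the
anti-holomorphic coset of the RC-category.  MODEL ≠ reconstruction; campaign-L support (GAP row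
G-L4t14-R1, J1); nothing here bears on [IUTchIII] Cor. 3.12; typed ≠ proved.
-/

set_option autoImplicit false

noncomputable section

open scoped Manifold ContDiff Topology UpperHalfPlane MatrixGroups
open _root_.MulAction _root_.CategoryTheory

namespace Literature.AnabelianGeometry.AbsoluteAnabelian

namespace HolRS

variable (Γ : Subgroup PSL2R) [ProperlyDiscontinuousSMul Γ ℍ] [IsCancelSMul Γ ℍ]
  (hfin : ∀ (g : PSL2R) (Λ₁ Λ₂ : LocObj Γ),
    (∀ x ∈ Λ₁.toSubgroup, g * x * g⁻¹ ∈ Λ₂.toSubgroup) →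
    ((Literature.Geometry.Manifold.QuotientManifold.conjSubgroup g Λ₁.toSubgroup).subgroupOf
      Λ₂.toSubgroup).FiniteIndex)

/-- **`Loc(PSL₂(ℝ), Γ̄) ⥤ HolRS` is FULL**: every morphism `ℍ/Λ̄₁ ⟶ ℍ/Λ̄₂` of the geometric `EA` comes
from a `[q] : Λ̄₁ → Λ̄₂`, `q Λ̄₁ q⁻¹ ≤ Λ̄₂` (`exists_psl_of_hom`).
[cite: MochizukiAbsTopIII2015, Proposition 4.2 (i) proof p.106] -/
theorem pslLocFunctor_full : (pslLocFunctor Γ hfin).Full where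
  map_surjective {Λ₁ Λ₂} f := by
    haveI : ProperlyDiscontinuousSMul Λ₁.toSubgroup ℍ :=
      Subgroup.properlyDiscontinuousSMul_of_le ‹ProperlyDiscontinuousSMul Γ ℍ› Λ₁.le
    haveI : IsCancelSMul Λ₁.toSubgroup ℍ := isCancelSMul_of_le upperHalfPlane Γ Λ₁.le
    haveI : ProperlyDiscontinuousSMul Λ₂.toSubgroup ℍ :=
      Subgroup.properlyDiscontinuousSMul_of_le ‹ProperlyDiscontinuousSMul Γ ℍ› Λ₂.le
    haveI : IsCancelSMul Λ₂.toSubgroup ℍ := isCancelSMul_of_le upperHalfPlane Γ Λ₂.le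
    obtain ⟨q, hq, hconj⟩ := exists_psl_of_hom Λ₁.toSubgroup Λ₂.toSubgroup f
    refine ⟨LocObj.homMk q hconj, ?_⟩
    apply hom_ext
    funext y
    induction y using Quotient.inductionOn with
    | h τ =>
      rw [hq τ]
      rfl

/-- **`Loc(PSL₂(ℝ), Γ̄) ⥤ HolRS` is FAITHFUL**: if `[τ] ↦ [q • τ]` and `[τ] ↦ [q' • τ]` coincide on
`ℍ/Λ̄₁ → ℍ/Λ̄₂`, then `q' q⁻¹ ∈ Λ̄₂` (choose `m ∈ Λ̄₂` with `m q I = q' I`; `(m q) • ·` and `q' • ·` are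
lifts of the same map through `ℍ → ℍ/Λ̄₂` agreeing at `I`, hence equal by `UniformizedLift.lift_unique`;
the action of `PSL₂(ℝ)` is faithful). [cite: MochizukiAbsTopIII2015, Proposition 4.2 (i) proof p.106] -/
theorem pslLocFunctor_faithful : (pslLocFunctor Γ hfin).Faithful where
  map_injective {Λ₁ Λ₂} := by
    intro a b hab
    obtain ⟨q, hq, rfl⟩ := LocObj.exists_eq_homMk a
    obtain ⟨q', hq', rfl⟩ := LocObj.exists_eq_homMk b
    haveI : ProperlyDiscontinuousSMul Λ₂.toSubgroup ℍ :=
      Subgroup.properlyDiscontinuousSMul_of_le ‹ProperlyDiscontinuousSMul Γ ℍ› Λ₂.le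
    haveI : IsCancelSMul Λ₂.toSubgroup ℍ := isCancelSMul_of_le upperHalfPlane Γ Λ₂.le
    -- the two maps agree on classes
    have hpt : ∀ τ : ℍ, (Quotient.mk (orbitRel Λ₂.toSubgroup ℍ) (q • τ)) =
        Quotient.mk (orbitRel Λ₂.toSubgroup ℍ) (q' • τ) := fun τ => by
      have := congrArg (fun φ : (pslLocFunctor Γ hfin).obj Λ₁ ⟶ (pslLocFunctor Γ hfin).obj Λ₂ =>
        φ.toFun (Quotient.mk _ τ)) hab
      exact this
    -- `m ∈ Λ̄₂` with `m • q • I = q' • I`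
    obtain ⟨m, hm⟩ := Quotient.exact (hpt UpperHalfPlane.I).symm
    -- both `(m q) • ·` and `q' • ·` lift the same map through `π₂` and agree at `I`
    let π₂ : ℍ → orbitRel.Quotient Λ₂.toSubgroup ℍ := Quotient.mk _
    have hπ₂ : IsCoveringMap π₂ :=
      (isQuotientCoveringMap_quotientMk_of_properlyDiscontinuousSMul
        (G := Λ₂.toSubgroup) (E := ℍ)).isCoveringMap
    have hlift : (fun τ : ℍ => ((m : PSL2R) * q) • τ) = fun τ : ℍ => q' • τ := by
      refine UniformizedLift.lift_unique (π₁ := fun τ : ℍ => τ) (h := fun τ : ℍ => π₂ (q' • τ))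
        hπ₂ (continuous_const_smul _) (continuous_const_smul _) (fun τ => ?_) (fun _ => rfl)
        (e₁ := UpperHalfPlane.I) ?_
      · change (Quotient.mk (orbitRel Λ₂.toSubgroup ℍ) (((m : PSL2R) * q) • τ)) =
          Quotient.mk (orbitRel Λ₂.toSubgroup ℍ) (q' • τ)
        rw [mul_smul, ← hpt τ]
        exact Quotient.sound ⟨m, rfl⟩
      · rw [mul_smul]
        exact hm
    have hone : q'⁻¹ * ((m : PSL2R) * q) = 1 := by
      refine psl_eq_one_of_forall_smul_eq fun τ => ?_
      rw [mul_smul, congr_fun hlift τ, inv_smul_smul]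
    rw [LocObj.homMk_eq_homMk_iff]
    have : q' * q⁻¹ = (m : PSL2R) := by
      calc q' * q⁻¹ = q' * (q'⁻¹ * ((m : PSL2R) * q)) * q⁻¹ := by rw [hone, mul_one]
        _ = (m : PSL2R) := by group
    rw [this]
    exact m.2

/-! ### Essential surjectivity onto the objects mapping to `ℍ/Γ̄` -/

/-- **Every object of `HolRS` mapping to `ℍ/Γ̄` is (isomorphic to) some `ℍ/Λ̄`, `Λ̄ ≤ Γ̄` of finite
index** — essential surjectivity of `Loc(PSL₂(ℝ), Γ̄) ⥤ HolRS` onto print's «objects that map to X»: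
the connected finite étale cover `Y → ℍ/Γ̄` is `ℍ/Λ̄ ≃ₜ Y` over `ℍ/Γ̄` for the stabiliser `Λ̄` of a lift
`ℍ → Y` (Hatcher Thm. 1.38, abc-iut-w5-d208's `SimplyConnectedCover.exists_subgroup_homeomorph_orbitQuotient`,
finite index by `finiteIndex_of_finite_fibre`), and a homeomorphism over `ℍ/Γ̄` between objects of
`HolRS` is an isomorphism (abc-iut-L4-t12's `HolRS.isoOfHomeomorphOver`).
[cite: MochizukiAbsTopIII2015, Proposition 4.2 (i) proof p.106] -/
theorem exists_iso_pslLocFunctor_obj (Y : HolRS) (fY : Y ⟶ pslQuotient Γ) :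
    ∃ Λ : LocObj Γ, Nonempty ((pslLocFunctor Γ hfin).obj Λ ≅ Y) := by
  -- the uniformisation `π : ℍ → ℍ/Γ̄`
  let π : ℍ → (pslQuotient Γ).carrier := Quotient.mk (orbitRel Γ ℍ)
  have hπ : IsCoveringMap π :=
    (isQuotientCoveringMap_quotientMk_of_properlyDiscontinuousSMul (G := Γ) (E := ℍ)).isCoveringMap
  have hdeck : ∀ γ ∈ Γ, ∀ m : ℍ, π (γ • m) = π m := fun γ hγ m =>
    Quotient.sound ⟨⟨γ, hγ⟩, rfl⟩
  haveI : LocallyConnectedSpace (pslQuotient Γ).carrier :=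
    inferInstanceAs (LocallyConnectedSpace (orbitRel.Quotient Γ ℍ))
  have horb : ∀ m m' : ℍ, π m = π m' → ∃ γ ∈ Γ, γ • m = m' := by
    intro m m' h
    obtain ⟨g, hg⟩ := Quotient.exact h
    exact ⟨((g⁻¹ : Γ) : PSL2R), (g⁻¹).2, by rw [← hg]; exact inv_smul_smul g m'⟩
  -- a base point
  obtain ⟨y₀⟩ := (inferInstance : Nonempty Y.carrier)
  obtain ⟨m₀, hm₀⟩ := Quotient.exists_rep (fY.toFun y₀)
  have h0 : fY.toFun y₀ = π m₀ := hm₀.symm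
  obtain ⟨Λ, k, e, hΛΓ, hk, hpk, -, hΛ, -, hek, hpe, -⟩ :=
    Literature.Topology.CoveringSpaces.SimplyConnectedCover.exists_subgroup_homeomorph_orbitQuotient
      (Γ := Γ) hπ hdeck horb fY.isFiniteEtale.isCoveringMap h0
  haveI : (Λ.subgroupOf Γ).FiniteIndex :=
    Literature.Topology.CoveringSpaces.SimplyConnectedCover.finiteIndex_of_finite_fibre
      fY.isFiniteEtale.isCoveringMap hk.continuous hpk hdeck hΛ m₀ (fY.isFiniteEtale.finite_fibre _)
  let Λo : LocObj Γ := ⟨Λ, hΛΓ, inferInstance⟩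
  refine ⟨Λo, ⟨?_⟩⟩
  -- the structure morphism `ℍ/Λ̄ ⟶ ℍ/Γ̄` as the image of `[1] : Λ̄ → Γ̄`
  let fΛ : (pslLocFunctor Γ hfin).obj Λo ⟶ pslQuotient Γ :=
    (pslLocFunctor Γ hfin).map
      (LocObj.homMk (Λ₁ := Λo) (Λ₂ := LocObj.top Γ) 1 fun x hx => by simpa using hΛΓ hx)
  refine isoOfHomeomorphOver fΛ fY e ?_
  funext z
  induction z using Quotient.inductionOn with
  | h m =>
    change fY.toFun (e (Quotient.mk _ m)) = Quotient.mk _ ((1 : PSL2R) • m)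
    rw [hpe m, one_smul]

/-! ### The equivalence `Loc(PSL₂(ℝ), Γ̄) ≌ «objects of HolRS mapping to ℍ/Γ̄»` -/

/-- Every `ℍ/Λ̄` maps to `ℍ/Γ̄` (the image of `[1] : Λ̄ → Γ̄`). [cite: MochizukiAbsTopIII2015, Proposition 4.2 (i) proof p.106] -/
theorem nonempty_hom_pslLocFunctor_obj (Λ : LocObj Γ) :
    Nonempty ((pslLocFunctor Γ hfin).obj Λ ⟶ pslQuotient Γ) :=
  ⟨(pslLocFunctor Γ hfin).map
    (LocObj.homMk (Λ₁ := Λ) (Λ₂ := LocObj.top Γ) 1 fun x hx => by simpa using Λ.le hx)⟩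

/-- ★ **[AbsTopIII] Prop 4.2 (i), «the full subcategory of `EA` consisting of objects that map to `X`
… may be identified with `Loc_R(X)`», AT THE UNIFORMISED MODEL: for `X = ℍ/Γ̄` (`Γ̄ ≤ PSL₂(ℝ)` acting
freely and properly discontinuously) the functor `Λ̄ ↦ ℍ/Λ̄`, `[q] ↦ ([τ] ↦ [q • τ])` is an EQUIVALENCE
of categories `Loc(PSL₂(ℝ), Γ̄) ≌ {Y ∈ HolRS | Y maps to ℍ/Γ̄}` (full + faithful + essentially
surjective, above).  Honest scope: holomorphic morphisms only (print's RC-category adds the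
anti-holomorphic coset), trivial orbi-structure, finite-fibre hypothesis `hfin`; the abstract Galois-side
identification `Loc ≅ B(Π_X)`-data and Lemma 4.3 are elsewhere (abc-iut-L4-t14's `LocCategoryGroupModel*`).
[cite: MochizukiAbsTopIII2015, Proposition 4.2 (i) proof p.106] -/
theorem isEquivalence_lift_pslLocFunctor :
    (ObjectProperty.lift (fun Y : HolRS => Nonempty (Y ⟶ pslQuotient Γ)) (pslLocFunctor Γ hfin)
      (nonempty_hom_pslLocFunctor_obj Γ hfin)).IsEquivalence where
  faithful := by
    haveI := pslLocFunctor_faithful Γ hfin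
    infer_instance
  full := by
    haveI := pslLocFunctor_full Γ hfin
    infer_instance
  essSurj := ⟨fun Y => by
    obtain ⟨fY⟩ := Y.property
    obtain ⟨Λ, ⟨e⟩⟩ := exists_iso_pslLocFunctor_obj Γ hfin Y.obj fY
    exact ⟨Λ, ⟨ObjectProperty.isoMk _ e⟩⟩⟩

end HolRS

end Literature.AnabelianGeometry.AbsoluteAnabelian

end
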